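/-
Copyright (c) 2026 the pub-hodgecm-mathlib formalisation cell (harness21).  Prover seat hodgecm-mathlib-K2E3-p04 (g3), Track B ∕ K2-LIT
(build stream 29), h413 = `stmt-HodgeConjecture-24833`, line `K2_E3_EllipticInputs`, unit U4 «Keys» — road I («Keys' own road»: the rank-one intertwining
integral), brick I-4b «THE JUNCTION AT EVERY NON-SPLIT PLACE».  2026-09-04.
-/
import Summits.HodgeConjecture.HodgeConjecture.Theorems.K2E3SphericalCFunctionMacdonaldInertDyadic      -- ★ p856802 (this base, g3): the junction at every INERT place
import Summits.HodgeConjecture.HodgeConjecture.Theorems.K2E3SphericalCFunctionMacdonaldRamifiedWild    -- ★ p856958 (this base, g3): the junction at every RAMIFIED place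
import Literature.NumberTheory.Automorphic.Liu2021.LemD1AsPrintedIndexedNonVacuityTameSynthesis         -- ★ `isUnramifiedIn_of_ramificationIdx'_eq_one` (`e(w|v) = 1` at a non-split place ⇒ `v` unramified in `L`)
import HarnessLib

/-!
# h413 ∕ Track B «K2-LIT», unit U4 «Keys», road I brick I-4b: THE REDUCIBILITY JUNCTION «`i_G(χ)` reducible ⟺ `(B f'_K)(1) = 0`» AT EVERY NON-SPLIT PLACE OF `L⁺` — ONE ENTRY POINT,
# NO HYPOTHESIS ON RAMIFICATION OR RESIDUE CHARACTERISTIC   [Casselman1995 Thm. 6.6.2, §6.4; Keys1984 §7 Thm (2); Rogawski1990 §4.5, §12.2]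

Cell `pub/hodgecm-mathlib`, crux H413 = `stmt-HodgeConjecture-24833` (lane `--supports … --as helper`), route HCCMUnconditional; dealer K2E3-plan (g2) («I-3ℓ per MEMO-ROAD-I-v2»;
(=) 02:41Z).  THEOREMS ONLY (0 def ∕ 0 instance ∕ 0 notation ∕ 0 sorry); ★-only imports.  The capstone of road I's place-by-place chain: ★ p856463 (junction at `v ∤ 2`, inert and
tame-ramified) → ★ p856802 (every inert place, via the trace-one element ★ p856746) → ★ p856958 (every ramified place, via the fibre product ★ p856853 and the ramified quadratic datum
★ p856896).  A place `v` of `L⁺` non-split in `L` has ONE place `w` above it, and either `e(w|v) = 1` — then `v` is unramified in `L` in Mathlib's sense (★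
`isUnramifiedIn_of_ramificationIdx'_eq_one`) and the inert junction applies — or `e(w|v) ≠ 1` and the ramified junction applies.  Hence:

* §1 **`reducible_iff_forall_counterIntertwiner_eval_eq_zero`** — at EVERY non-split `v`, for `χ₁` unramified with `|χ₁| = ‖·‖^s`, `s > 0`, `χ₂(−1) = 1`, spherical `f_K, f'_K` normalised at
  `1`: `i_G(χ₁, χ₂)` reducible ⟺ every `G`-map `B : i(wχ) → i(χ)` has `(B f'_K)(1) = 0`.
* §2 **`reducible_iff_forall_counterIntertwiner_eval_eq_zero_of_trivial`** — the same in the organ's currency: `χ` trivial on `T ∩ K_v` and `χ₁` contracting (★ p856288 (H1)–(H3)).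
What U4-f still needs on the unramified line is only the NUMBER `(B f'_K)(1)` (road II, the Iwahori line: K2E3-p05's II-4), now at every non-split place; off the unramified line, the
ramified-`χ₁` half (Keys §4–§6; source acq-15210).

HONEST LABEL.  HC_CM is proved only modulo the 7 printed citations (2 remaining named inputs: hLiu418 = `stmt-HodgeConjecture-24832`, h413 = `stmt-HodgeConjecture-24833`) until
rung 0 closes; count-neutral (road I helper toward U4-f).

## References
* [Casselman1995] W. Casselman, *Introduction to the theory of admissible representations of `p`-adic reductive groups* (1995), §6.4 pp. 62–64, Thm. 6.6.2 p. 66.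
* [Keys1984] D. Keys, *Principal series representations of special unitary groups over local fields*, Compositio Math. 51 (1984), §3, §4, §7 Thm (2).
* [Rogawski1990] J. D. Rogawski, *Automorphic Representations of Unitary Groups in Three Variables*, Ann. of Math. Stud. 123 (1990), §4.5 p. 45, §12.1 p. 171, §12.2 p. 173.
* [NeukirchANT1999] J. Neukirch, *Algebraic Number Theory* (1999), Ch. I §8 Prop. (8.2), §9 (one prime above a non-split place; `e f = 2`).
* [CartierCorvallis1979] P. Cartier, *Representations of `p`-adic groups: a survey*, Proc. Symp. Pure Math. 33 (1979), §IV.1.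
-/

set_option autoImplicit false
-- the mandated namespace repeats the single-problem summit's segment (`HodgeConjecture.HodgeConjecture`)
set_option linter.dupNamespace false

noncomputable section

open NumberField IsDedekindDomain MeasureTheory
open scoped Matrix NNReal ENNReal

open Literature.NumberTheory Literature.NumberTheory.Automorphic Literature.NumberTheory.Automorphic.UnitaryGroup
open Literature.NumberTheory.GaloisRepresentations Literature.NumberTheory.GaloisRepresentations.IsNonarchimedeanLocalField

namespace Summit.HodgeConjecture.HodgeConjecture.Cruxes.H413.K2E3SphericalReducibilityJunctionNonsplit

variable (L : Type) [Field L] [NumberField L] [IsCMField L] (v : HeightOneSpectrum (𝓞 ↥(maximalRealSubfield L)))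

/-! ## §1 The junction at every non-split place (working hypotheses) -/

set_option synthInstance.maxHeartbeats 400000 in
set_option maxHeartbeats 8000000 in
-- statement∕proof over two `SmoothInd` carriers of ★ `cmPrincipalSeries` (class of ★ `K2E3SphericalReducibilityJunction.reducible_iff_forall_counterIntertwiner_eval_eq_zero_inert`)
/-- **THE JUNCTION AT EVERY NON-SPLIT PLACE OF `L⁺` — NO HYPOTHESIS ON RAMIFICATION OR RESIDUE CHARACTERISTIC.**  `v` non-split (`c • w = w` for all `w ∣ v`), `w₀` of matrix `Φ₃`, `μ` Haar on
`N(L⁺_v)`, `ϖ` a uniformiser unit; `χ₁, χ₂` continuous, `χ₂(−1) = 1`, `χ₁ = 1` on `𝒪_vˣ`, `|χ₁| = ‖·‖^s` with `s > 0` (so `χ` is regular and `|z| < 1`, `z = χ₁(ϖ)`); `f_K ∈ i(χ)^{K_v}`,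
`f'_K ∈ i(wχ)^{K_v}` with `f_K(1) = f'_K(1) = 1`.  Then **`i_G(χ)` is reducible ⟺ `(B f'_K)(1) = 0` for every `G`-map `B : i(wχ) → i(χ)`** — by cases on `e(w|v)`: `e = 1` ⇒ `v` unramified
in `L` (★ `isUnramifiedIn_of_ramificationIdx'_eq_one`, one place above `v`) and ★ p856802 §5 (inert, any residue characteristic); `e ≠ 1` ⇒ ★ p856958 §4 (ramified, tame or wild).  This is
the single entry point of road I for U4-f `sig_K2E3KeysThmTwoContracting` on the unramified line: Keys' Theorem (2) there is the statement «`(B f'_K)(1) = 0` exactly at `χ₁ = ‖·‖_E`, or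
`χ₁ = η‖·‖_E^{1∕2}` (inert, `η(ϖ) = −1`)», the number `(B f'_K)(1)` being road II's (the Iwahori line). [cite: Casselman1995, Thm. 6.6.2 p. 66; §6.4] [cite: Keys1984, §7 Thm (2); §3]
[cite: Rogawski1990, §4.5 p. 45; §12.2 p. 173] [cite: NeukirchANT1999, Ch. I §8] -/
theorem reducible_iff_forall_counterIntertwiner_eval_eq_zero (hns : ∀ w : PlacesOver L v, IsCMField.complexConj L • w.1 = w.1) (w : PlacesOver L v)
    (χ₁ : (LocalRing L v)ˣ →* ℂˣ) (χ₂ : ↥(normOneUnits (conjLocal L (IsCMField.complexConj L) v)) →* ℂˣ) (h₁ : Continuous fun x => ((χ₁ x : ℂˣ) : ℂ)) (h₂ : Continuous fun x => ((χ₂ x : ℂˣ) : ℂ)) (hχ₂ : χ₂ ⟨-1, F0P3cStCharTSBigCellFactorisation.neg_one_mem_normOneUnits (conjLocal L (IsCMField.complexConj L) v)⟩ = 1)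
    (hunr : ∀ u ∈ (Submonoid.pi Set.univ (fun w : PlacesOver L v => (w.1.adicCompletionIntegers L).toSubring.toSubmonoid)).units, χ₁ u = 1) {s : ℝ} (hs : 0 < s)
    (hχ₁ : ∀ x : (LocalRing L v)ˣ, ‖((χ₁ x : ℂˣ) : ℂ)‖ = ((unitModulusChar (LocalRing L v) x : ℝ≥0) : ℝ) ^ s)
    (ϖ : (LocalRing L v)ˣ) (hϖ : ∀ w : PlacesOver L v, Valued.v ((ϖ : LocalRing L v) w) = WithZero.exp (-1 : ℤ))
    (w₀ : ↥(unitaryGroupOfForm (conjLocal L (IsCMField.complexConj L) v) (cmLocalForm L 3 v))) (hw₀ : Units.val (w₀ : GL (Fin 3) (LocalRing L v)) = cmLocalForm L 3 v)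
    [MeasurableSpace ↥(cmBorelTriple L 3 v).N] [BorelSpace ↥(cmBorelTriple L 3 v).N] (μ : Measure ↥(cmBorelTriple L 3 v).N) [μ.IsHaarMeasure]
    (fK : haveI := locallyCompactSpace_cmBorelU L 3 v
      Representation.SmoothInd (cmBorelTriple L 3 v).P (Representation.twist (((Representation.trivial ℂ ↥(torusU (conjLocal L (IsCMField.complexConj L) v) (cmLocalForm L 3 v)) ℂ).twist
        (cmTorusCharPair L v χ₁ χ₂)).comp (cmBorelTriple L 3 v).proj) (rootDeltaChar (cmBorelTriple L 3 v).P)))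
    (hfK : haveI := locallyCompactSpace_cmBorelU L 3 v
      fK ∈ (Representation.smoothIndRep (cmBorelTriple L 3 v).P _).fixedPoints (cmLocalIntegralLevel L 3 (Matrix.of fun i j : Fin 3 => if i.val + j.val + 1 = 3 then (1 : L) else 0) v)) (hK1 : fK.toFun 1 = 1)
    (fK' : haveI := locallyCompactSpace_cmBorelU L 3 v
      Representation.SmoothInd (cmBorelTriple L 3 v).P (Representation.twist (((Representation.trivial ℂ ↥(torusU (conjLocal L (IsCMField.complexConj L) v) (cmLocalForm L 3 v)) ℂ).twist
        (cmTorusCharPair L v (conjInvChar (conjLocal L (IsCMField.complexConj L) v) χ₁) χ₂)).comp (cmBorelTriple L 3 v).proj) (rootDeltaChar (cmBorelTriple L 3 v).P)))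
    (hfK' : haveI := locallyCompactSpace_cmBorelU L 3 v
      fK' ∈ (Representation.smoothIndRep (cmBorelTriple L 3 v).P _).fixedPoints (cmLocalIntegralLevel L 3 (Matrix.of fun i j : Fin 3 => if i.val + j.val + 1 = 3 then (1 : L) else 0) v)) (hK'1 : fK'.toFun 1 = 1) :
    (∃ N : Subrepresentation (cmPrincipalSeries L 3 v (cmTorusCharPair L v χ₁ χ₂)), N ≠ ⊥ ∧ N ≠ ⊤) ↔
      ∀ (B : (cmPrincipalSeries L 3 v (cmTorusCharPair L v (conjInvChar (conjLocal L (IsCMField.complexConj L) v) χ₁) χ₂)).IntertwiningMap (cmPrincipalSeries L 3 v (cmTorusCharPair L v χ₁ χ₂))), (B fK').toFun 1 = 0 := by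
  haveI : Algebra.IsQuadraticExtension ↥(maximalRealSubfield L) L := IsCMField.isQuadraticExtension L
  by_cases he : v.asIdeal.ramificationIdx' w.1.asIdeal = 1
  · exact K2E3SphericalCFunctionMacdonaldInertDyadic.reducible_iff_forall_counterIntertwiner_eval_eq_zero_inert L v hns w
      (Liu2021.LemD1IndexedNonVacuityTameSynthesis.isUnramifiedIn_of_ramificationIdx'_eq_one L (IsCMField.complexConj L) v (IsCMField.complexConj_ne_one L) w (hns w) he)
      χ₁ χ₂ h₁ h₂ hχ₂ hunr hs hχ₁ ϖ hϖ w₀ hw₀ μ fK hfK hK1 fK' hfK' hK'1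
  · exact K2E3SphericalCFunctionMacdonaldRamifiedWild.reducible_iff_forall_counterIntertwiner_eval_eq_zero_ramified L v hns w he χ₁ χ₂ h₁ h₂ hχ₂ hunr hs hχ₁ ϖ hϖ w₀ hw₀ μ
      fK hfK hK1 fK' hfK' hK'1

/-! ## §2 The junction at every non-split place in the organ's currency -/

set_option synthInstance.maxHeartbeats 400000 in
set_option maxHeartbeats 8000000 in
-- statement∕proof over two `SmoothInd` carriers of ★ `cmPrincipalSeries` (class of ★ `K2E3SphericalCFunctionOrganCurrency.exists_intertwiningIntegral_sphericalVector_eq_macdonald_smul_of_trivial`)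
/-- **THE JUNCTION AT EVERY NON-SPLIT PLACE, ORGAN CURRENCY.**  `v` non-split; `χ = (χ₁, χ₂)` continuous, TRIVIAL ON `T ∩ K_v` (`hχK`) and `χ₁` CONTRACTING (`‖x‖ < 1 ⇒ |χ₁ x| < 1` — the
hypothesis `hKpos`-shape of U4-f); `w₀`, `μ`, `ϖ` as in §1; `f_K ∈ i(χ)^{K_v}`, `f'_K ∈ i(wχ)^{K_v}`, `f_K(1) = f'_K(1) = 1` (both exist: ★ `exists_sphericalVector` with `hχK`, resp. ★
`trivial_weyl_of_trivial`).  Then **`i_G(χ)` reducible ⟺ `∀ B : i(wχ) → i(χ)`, `(B f'_K)(1) = 0`** — ★ p856288's working hypotheses (H1) `χ₁ = 1` on `𝒪_vˣ`, (H2) `χ₂(−1) = 1`,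
(H3) `|χ₁| = ‖·‖^s`, `s > 0`, then §1. [cite: Casselman1995, Thm. 6.6.2 p. 66] [cite: Keys1984, §7 Thm (2)] [cite: Rogawski1990, §12.1 p. 171; §12.2 p. 173] [cite: CartierCorvallis1979, §IV.1] -/
theorem reducible_iff_forall_counterIntertwiner_eval_eq_zero_of_trivial (hns : ∀ w : PlacesOver L v, IsCMField.complexConj L • w.1 = w.1) (w : PlacesOver L v)
    (χ₁ : (LocalRing L v)ˣ →* ℂˣ) (χ₂ : ↥(normOneUnits (conjLocal L (IsCMField.complexConj L) v)) →* ℂˣ)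
    (h₁ : Continuous fun x => ((χ₁ x : ℂˣ) : ℂ)) (h₂ : Continuous fun x => ((χ₂ x : ℂˣ) : ℂ))
    (hχK : ∀ t : ↥(torusU (conjLocal L (IsCMField.complexConj L) v) (cmLocalForm L 3 v)), (t : ↥(unitaryGroupOfForm (conjLocal L (IsCMField.complexConj L) v) (cmLocalForm L 3 v))) ∈ cmLocalIntegralLevel L 3 (Matrix.of fun i j : Fin 3 => if i.val + j.val + 1 = 3 then (1 : L) else 0) v → cmTorusCharPair L v χ₁ χ₂ t = 1)
    (hcontr : ∀ x : (LocalRing L v)ˣ, unitModulusChar (LocalRing L v) x < 1 → ‖((χ₁ x : ℂˣ) : ℂ)‖ < 1)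
    (ϖ : (LocalRing L v)ˣ) (hϖ : ∀ w : PlacesOver L v, Valued.v ((ϖ : LocalRing L v) w) = WithZero.exp (-1 : ℤ))
    (w₀ : ↥(unitaryGroupOfForm (conjLocal L (IsCMField.complexConj L) v) (cmLocalForm L 3 v))) (hw₀ : Units.val (w₀ : GL (Fin 3) (LocalRing L v)) = cmLocalForm L 3 v)
    [MeasurableSpace ↥(cmBorelTriple L 3 v).N] [BorelSpace ↥(cmBorelTriple L 3 v).N] (μ : Measure ↥(cmBorelTriple L 3 v).N) [μ.IsHaarMeasure]
    (fK : haveI := locallyCompactSpace_cmBorelU L 3 v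
      Representation.SmoothInd (cmBorelTriple L 3 v).P (Representation.twist (((Representation.trivial ℂ ↥(torusU (conjLocal L (IsCMField.complexConj L) v) (cmLocalForm L 3 v)) ℂ).twist
        (cmTorusCharPair L v χ₁ χ₂)).comp (cmBorelTriple L 3 v).proj) (rootDeltaChar (cmBorelTriple L 3 v).P)))
    (hfK : haveI := locallyCompactSpace_cmBorelU L 3 v
      fK ∈ (Representation.smoothIndRep (cmBorelTriple L 3 v).P _).fixedPoints (cmLocalIntegralLevel L 3 (Matrix.of fun i j : Fin 3 => if i.val + j.val + 1 = 3 then (1 : L) else 0) v)) (hK1 : fK.toFun 1 = 1)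
    (fK' : haveI := locallyCompactSpace_cmBorelU L 3 v
      Representation.SmoothInd (cmBorelTriple L 3 v).P (Representation.twist (((Representation.trivial ℂ ↥(torusU (conjLocal L (IsCMField.complexConj L) v) (cmLocalForm L 3 v)) ℂ).twist
        (cmTorusCharPair L v (conjInvChar (conjLocal L (IsCMField.complexConj L) v) χ₁) χ₂)).comp (cmBorelTriple L 3 v).proj) (rootDeltaChar (cmBorelTriple L 3 v).P)))
    (hfK' : haveI := locallyCompactSpace_cmBorelU L 3 v
      fK' ∈ (Representation.smoothIndRep (cmBorelTriple L 3 v).P _).fixedPoints (cmLocalIntegralLevel L 3 (Matrix.of fun i j : Fin 3 => if i.val + j.val + 1 = 3 then (1 : L) else 0) v))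
    (hK'1 : fK'.toFun 1 = 1) :
    (∃ N : Subrepresentation (cmPrincipalSeries L 3 v (cmTorusCharPair L v χ₁ χ₂)), N ≠ ⊥ ∧ N ≠ ⊤) ↔
      ∀ (B : (cmPrincipalSeries L 3 v (cmTorusCharPair L v (conjInvChar (conjLocal L (IsCMField.complexConj L) v) χ₁) χ₂)).IntertwiningMap (cmPrincipalSeries L 3 v (cmTorusCharPair L v χ₁ χ₂))), (B fK').toFun 1 = 0 := by
  have hunr := K2E3SphericalCFunctionUnramifiedHypotheses.apply_eq_one_of_mem_unitsIntegers_of_trivial L v hns χ₁ χ₂ hχK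
  have hχ₂ := K2E3SphericalCFunctionUnramifiedHypotheses.apply_neg_one_eq_one_of_trivial L v hns χ₁ χ₂ hχK
  obtain ⟨s, hs, hχ₁⟩ := K2E3SphericalCFunctionUnramifiedHypotheses.exists_rpow_modulus_of_unramified_of_contracting L v hns χ₁ hunr hcontr
  exact reducible_iff_forall_counterIntertwiner_eval_eq_zero L v hns w χ₁ χ₂ h₁ h₂ hχ₂ hunr hs hχ₁ ϖ hϖ w₀ hw₀ μ fK hfK hK1 fK' hfK' hK'1

end Summit.HodgeConjecture.HodgeConjecture.Cruxes.H413.K2E3SphericalReducibilityJunctionNonsplit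

end
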